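import Summits.BirchSwinnertonDyer.BirchSwinnertonDyer.Theorems.ByReductionTypeAtTwoRankOneAtTwoBigImageOddLocalOneDoorSubsliceDescentBits
import Summits.BirchSwinnertonDyer.BirchSwinnertonDyer.Theorems.ByReductionTypeAtTwoRankOneAtTwoBigImageOddLocalOneDoorBottomSubsliceCTFree
import Summits.BirchSwinnertonDyer.BirchSwinnertonDyer.Theorems.ByReductionTypeAtTwoRankOneAtTwoBigImageOddLocalOneDoorSubsliceSplit
import Literature.NumberTheory.EllipticCurves.BSDHeegnerPointsGrossZagierProofs
import Literature.NumberTheory.EllipticCurves.GrossZagierRankOneProofs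
import Summits.BirchSwinnertonDyer.BirchSwinnertonDyer.Theorems.GenusKolyvaginAtTwoGenusPrimitiveSupplyAtTwoPrimeHeegnerTwinSilentPrimes
import Summits.BirchSwinnertonDyer.BirchSwinnertonDyer.Theorems.TwoAdicConverseFrobeniusParityNonsquareDiscriminant
import Summits.BirchSwinnertonDyer.Rank1Residual.F1Sign2.HeegnerEggAtTwo
import Summits.BirchSwinnertonDyer.Rank1Residual.F1Sign2.DoorValueSupplyAtTwoProofs
import HarnessLib

/-!
# Route ByReductionTypeAtTwo, crux `RankOneAtTwoBigImageOddLocal` (stmt-BirchSwinnertonDyer-23715), LINE v8.14/v8.15 `one_door_analytic`: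
# THE `Δ_W > 0` TWIN OF R⁻₀ — a Heegner point ON THE EGG is a bottom-rung datum, and under -an's AN-13 `HeegnerPointOnEggAtTwo` the whole class
# {`Δ_W > 0`, `Ш(W)[2] = 0`, `E(ℚ)` meets the egg, an odd-constant datum exists} lies on the PROVED sub-slice (door supplied, `L`-value free)

Width prover seat `bsd-line-fkl-p2` g13 (2026-08-28), `--supports stmt-BirchSwinnertonDyer-23715` (helper); companion of
`Theorems/…OneDoorSubsliceDescentBits.lean` (the converse shadow: a bottom-rung datum at `Δ_W > 0` forces the egg bit, modulo print) and the `Δ_W > 0`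
mirror of the lead's `Theorems/…OneDoorSubsliceNegDisc.lean` (R⁻₀, `Δ_W < 0`).  THEOREMS ONLY (no definition, no named fact, no `sorry`).  BSD is not
proved by any of this; nothing is asserted about AN-13 `F1Sign2.HeegnerPointOnEggAtTwo` (conjecture-grade, -an g5, REF1 §31) — it is a HYPOTHESIS where named.

* §1 exponent `0` from the egg (`hasTwoDivisibilityUpToTorsion_zero_of_eggUpToTorsion`: the tree's EGG LEMMA `EggDoubling.eggLemma`, unconditional);
* §2 **`hasBottomRungDoorAtTwo_of_eggUpToTorsion`** — a minimal odd-constant non-vanishing admissible door datum whose Heegner point is rational-on-the-egg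
  up to torsion IS a bottom-rung datum (UNCONDITIONAL); `…_of_grossZagier` — the same with the door's non-vanishing DERIVED («the door opens itself»:
  exponent `0` ⟹ infinite order ⟹ `L'(E/K,1) ≠ 0` (Gross–Zagier) ⟹ `L(W^{(d_K)},1) ≠ 0`; the kernel tail of -an's AN-34 (e) certificate chain);
  `bsdp_two_at_eggDatum_ctFree` — hence `BSDp W 2` modulo the five printed facts and the four rank-`0` cruxes;
* §3 door bookkeeping for -desc's parameter: `transpCount_eq_zero_of_descAdmissible` (odd `a_q` ⟹ `(Δ_min/q) = +1`), `identCount_eq_zero_of_descAdmissible`,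
  `minimal_of_descAdmissible_of_pos` (`DoorAdmissible` itself by -an's `ANg16.doorAdmissible_of_descAdmissible`);
* §4 **THE CLASS THEOREM `hasBottomRungDoorAtTwo_of_heegnerPointOnEggAtTwo`**: AN-13 + Gross–Zagier + Kolyvagin + modularity + Hoffstein–Luo ⟹ every `W`
  of the slice with `Δ_W > 0`, `Ш(W)[2] = 0`, `MeetsEgg W` and an ODD-constant datum ADMITS A BOTTOM-RUNG DOOR DATUM — door SUPPLIED by route
  GenusKolyvaginAtTwo's `GenusKolyTwin.exists_silent_prime_heegnerField` (desc-admissible `K = ℚ(√−ℓ)`, Heegner; unconditional), `K`-point by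
  `heegnerPointComplex_mem_range_map_holds`, exponent `0` by AN-13 + egg lemma, non-vanishing by Gross–Zagier as in §2, minimal model by
  `hasGlobalMinimalModel_rat_holds`; **`bsdp_two_of_heegnerPointOnEggAtTwo_posDisc`** (`BSDp W 2` on the class modulo AN-13, print, rank-`0` cruxes);
  `not_offSubslice_of_heegnerPointOnEggAtTwo`; and the v8.16-pattern compositions `doorIndexLawFullCAtTwoSomeDoorResiduePlus_of_eggClass_of_rest` /
  `…_of_heegnerPointOnEggAtTwo_of_rest` (R₊ from «the egg class lies on the sub-slice» + the residue off both classes — import-free);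
* §5 per-datum form at a GIVEN door (`hasBottomRungDoorAtTwo_of_heegnerPointOnEggAtTwo_at`) and the two-sided packaging with the companion file
  (`eggUpToTorsion_imp_bottomRung_imp_meetsEgg`: egg Heegner datum ⟹ sub-slice ⟹ egg bit, at `Δ_W > 0`).

References: [GrossLMS1991] §10; [Kolyvagin1990] Thm. A; [GrossZagier1986] I.6.3, V.§2; [Gross1984] §§3–5; [Kramer1981] Prop. 6; [Zhang2014CJM] Thm. 1.1.
-/

set_option autoImplicit false
-- the Theorems namespace of this sub repeats the summit name by design (D-0017 nested layout)
set_option linter.dupNamespace false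

noncomputable section

open scoped Classical

namespace Summit.BirchSwinnertonDyer.BirchSwinnertonDyer.Theorems.RankOneAtTwoOneDoor

open WeierstrassCurve NumberField Literature.NumberTheory.EllipticCurves Literature.NumberTheory.EllipticCurves.ModularForms
  Summit.BirchSwinnertonDyer.Rank1Residual.F1Sign2
  Summit.BirchSwinnertonDyer.Rank1Residual.F1Sign2.TranspositionDoor
  Summit.BirchSwinnertonDyer.BirchSwinnertonDyer.Theses.ByReductionTypeAtTwo
open Summit.BirchSwinnertonDyer.BirchSwinnertonDyer.Theorems.GenusKolyTwin (exists_silent_prime_heegnerField)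
open Summit.BirchSwinnertonDyer.BirchSwinnertonDyer.Theorems.TwoAdicTwistConverse (legendreSym_discr_eq_one_of_odd_frobeniusTrace)

/-! ### §1 Exponent `0` from the egg -/

/-- **`P ∉ 2E(K) + E(K)_tors` is exponent `0`**: `NotTwiceUpToTorsion W K P` gives `HasTwoDivisibilityUpToTorsion W K P 0` with witness `Q := P`
(`P − 2^0 • P = 0` is torsion). [folklore] -/
theorem hasTwoDivisibilityUpToTorsion_zero_of_notTwiceUpToTorsion (W : WeierstrassCurve ℚ) (K : Type) [Field K] [NumberField K]
    (P : (W.baseChange K).toAffine.Point) (h : NotTwiceUpToTorsion W K P) : HasTwoDivisibilityUpToTorsion W K P 0 := by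
  refine ⟨P, ?_, h⟩
  rw [pow_zero, one_smul, sub_self]
  exact AddSubgroup.zero_mem _

/-- **A point rational-on-the-egg up to torsion has exponent `0`** (`Δ_W > 0`, `E(ℚ)[2] = 0`, `K` imaginary quadratic): the EGG LEMMA
`EggDoubling.eggLemma` (a rational point on the egg is not in `2E(K) + E(K)_tors`) in the line's exponent currency.  UNCONDITIONAL.
[cite: Gross1984, §§3–5] [cite: SilvermanAEC2009, V.2.3.1] -/
theorem hasTwoDivisibilityUpToTorsion_zero_of_eggUpToTorsion (W : WeierstrassCurve ℚ) [W.IsElliptic] (hΔ : 0 < W.Δ)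
    (hT : NoRationalTwoTorsion W) (K : Type) [Field K] [NumberField K] (hK : IsImaginaryQuadratic K)
    (P : (W.baseChange K).toAffine.Point) (hegg : EggUpToTorsion W K P) : HasTwoDivisibilityUpToTorsion W K P 0 :=
  hasTwoDivisibilityUpToTorsion_zero_of_notTwiceUpToTorsion W K P (EggDoubling.eggLemma W hΔ hT K hK P hegg)

/-! ### §2 An egg Heegner datum is a bottom-rung datum -/

/-- **A MINIMAL ODD-CONSTANT NON-VANISHING ADMISSIBLE DOOR DATUM WHOSE HEEGNER POINT IS RATIONAL-ON-THE-EGG UP TO TORSION IS A BOTTOM-RUNG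
DATUM** (`Δ_W > 0`, `E(ℚ)[2] = 0`): `HasBottomRungDoorAtTwo W` with the same datum and exponent `0` by the egg lemma.  UNCONDITIONAL — no printed
fact, no conjecture: such `W` lies on the PROVED sub-slice of LINE v8.14. [cite: GrossLMS1991, §10] [cite: Gross1984, §§3–5] -/
theorem hasBottomRungDoorAtTwo_of_eggUpToTorsion
    (W : WeierstrassCurve ℚ) [W.IsElliptic] [W.IsGloballyMinimal] [NeZero (W.conductorNorm ℤ)]
    (hΔ : 0 < W.Δ) (hT : NoRationalTwoTorsion W)
    (K : Type) [iF : Field K] [iN : NumberField K] (hK : IsImaginaryQuadratic K) (hadm : DoorAdmissible W (NumberField.discr K))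
    (hLt : (W.quadraticTwist (NumberField.discr K : ℚ)).entireLFunction 1 ≠ 0)
    (hmin : transpCount W (NumberField.discr K) + 2 * identCount W (NumberField.discr K) = (if W.Δ < 0 then 1 else 0))
    (Dt : ModularParametrizationData W (W.conductorNorm ℤ)) (H : HeegnerDatum (W.conductorNorm ℤ) (NumberField.discr K))
    (ι : K →+* ℂ) (P : (W.baseChange K).toAffine.Point)
    (hP : WeierstrassCurve.Affine.Point.map ι.toRatAlgHom P = heegnerPointComplex Dt H) (hodd : Odd Dt.c)
    (Wd : WeierstrassCurve ℚ) [iE : Wd.IsElliptic] [iM : Wd.IsGloballyMinimal] (Cd : WeierstrassCurve.VariableChange ℚ)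
    (hWd : Cd • W.quadraticTwist (NumberField.discr K : ℚ) = Wd)
    (hegg : EggUpToTorsion W K P) : HasBottomRungDoorAtTwo W := by
  have hm : HasTwoDivisibilityUpToTorsion W K P 0 := hasTwoDivisibilityUpToTorsion_zero_of_eggUpToTorsion W hΔ hT K hK P hegg
  unfold HasBottomRungDoorAtTwo
  exact ⟨K, iF, iN, hK, hadm, hLt, hmin, Dt, H, ι, P, Wd, iE, iM, Cd, hP, hWd, hodd, hm⟩

/-- **THE SAME WITHOUT THE NON-VANISHING HYPOTHESIS — «the door opens itself»** (modulo Gross–Zagier and modularity, for analytic rank `1`):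
a minimal odd-constant admissible door datum whose Heegner point is rational-on-the-egg up to torsion is a bottom-rung datum, the door's
`L(W^{(d_K)},1) ≠ 0` being DERIVED (the lead's «door opens itself» step of R⁻₀, here in three tree lines): exponent `0` ⟹ infinite order
(`not_isOfFinAddOrder_of_hasTwoDivisibilityUpToTorsion_zero`) ⟹ `L'(E/K,1) ≠ 0` (Gross–Zagier, `lDerivEK_ne_zero_iff_not_isOfFinAddOrder`) ⟹
`L(W^{(d_K)},1) ≠ 0` (`L'(E/K,1) = L'(E,1)·L(W^{(d_K)},1)`, `lDerivEK_eq_deriv_mul_of_entireLFunction_one_eq_zero`).  This is the kernel of -an's AN-34 (e) chain «odd Heegner cusp symbol ⟹ `y_K` on the egg ⟹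
bottom-rung door» after its analytic first step.  CONDITIONAL on Gross–Zagier and modularity; BSD is not proved by this.
[cite: GrossZagier1986, Thm. I.6.3 and V.§2] [cite: Gross1984, §§3–5] [cite: GrossLMS1991, §10] -/
theorem hasBottomRungDoorAtTwo_of_eggUpToTorsion_of_grossZagier
    (hGZ : ∀ (N : ℕ) [NeZero N] (W : WeierstrassCurve ℚ) (K : Type) [Field K] [NumberField K], gross_zagier N W K)
    (hnf : exists_isNewformOf)
    (W : WeierstrassCurve ℚ) [W.IsElliptic] [W.IsGloballyMinimal] [NeZero (W.conductorNorm ℤ)]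
    (hr : W.analyticRank = 1) (hΔ : 0 < W.Δ) (hT : NoRationalTwoTorsion W)
    (K : Type) [iF : Field K] [iN : NumberField K] (hK : IsImaginaryQuadratic K) (hadm : DoorAdmissible W (NumberField.discr K))
    (hmin : transpCount W (NumberField.discr K) + 2 * identCount W (NumberField.discr K) = (if W.Δ < 0 then 1 else 0))
    (Dt : ModularParametrizationData W (W.conductorNorm ℤ)) (H : HeegnerDatum (W.conductorNorm ℤ) (NumberField.discr K))
    (ι : K →+* ℂ) (P : (W.baseChange K).toAffine.Point)
    (hP : WeierstrassCurve.Affine.Point.map ι.toRatAlgHom P = heegnerPointComplex Dt H) (hodd : Odd Dt.c)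
    (Wd : WeierstrassCurve ℚ) [iE : Wd.IsElliptic] [iM : Wd.IsGloballyMinimal] (Cd : WeierstrassCurve.VariableChange ℚ)
    (hWd : Cd • W.quadraticTwist (NumberField.discr K : ℚ) = Wd)
    (hegg : EggUpToTorsion W K P) : HasBottomRungDoorAtTwo W := by
  have hm0 : HasTwoDivisibilityUpToTorsion W K P 0 := hasTwoDivisibilityUpToTorsion_zero_of_eggUpToTorsion W hΔ hT K hK P hegg
  have hHN : SatisfiesHeegnerHypothesis (W.conductorNorm ℤ) K := satisfiesHeegnerHypothesis_of_doorAdmissible W K hK hadm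
  have hnt : ¬ IsOfFinAddOrder P := not_isOfFinAddOrder_of_hasTwoDivisibilityUpToTorsion_zero W K P hm0
  have hHeeg : IsHeegnerPoint (W.conductorNorm ℤ) W K P := ⟨Dt, H, ι, hP⟩
  have hLK : LDerivEK W K ≠ 0 :=
    (lDerivEK_ne_zero_iff_not_isOfFinAddOrder W (W.conductorNorm ℤ) K (hGZ _ W K) hK hHN hHeeg).mpr hnt
  have hmod : hasEntireLFunction_rat := hasEntireLFunction_rat_of_exists_isNewformOf hnf
  have hL0 : W.entireLFunction 1 = 0 := entireLFunction_one_eq_zero_of_analyticRank_eq_one hr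
  have hLt : (W.quadraticTwist (NumberField.discr K : ℚ)).entireLFunction 1 ≠ 0 := by
    intro h0
    apply hLK
    rw [lDerivEK_eq_deriv_mul_of_entireLFunction_one_eq_zero hmod W K hL0, h0, mul_zero]
  exact hasBottomRungDoorAtTwo_of_eggUpToTorsion W hΔ hT K hK hadm hLt hmin Dt H ι P hP hodd Wd Cd hWd hegg

/-- **`BSDp W 2` AT AN EGG HEEGNER DATUM, modulo FIVE printed facts and the route's four rank-`0` cruxes** (no Cassels–Tate): a curve of the slice
(`W` globally minimal, non-CM, `ρ_{W,2^n}` onto, odd torsion order, odd Tamagawa product, analytic rank `1`) with `Δ_W > 0` and a minimal odd-constant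
non-vanishing admissible door datum whose Heegner point is rational-on-the-egg up to torsion satisfies `BSDp W 2` — the width seat g12's
`bsdp_two_of_bottomRung_at_of_rankZero_cruxes_ctFree` at exponent `0` (§1).  CONDITIONAL by design; BSD is not proved by this.
[cite: GrossLMS1991, §10 and Prop. 3.7 (2)] [cite: Kolyvagin1990, Thm. A] [cite: GrossZagier1986, Thm. I.6.3 and V.§2] -/
theorem bsdp_two_at_eggDatum_ctFree
    (hGZ : ∀ (N : ℕ) [NeZero N] (W : WeierstrassCurve ℚ) (K : Type) [Field K] [NumberField K], gross_zagier N W K)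
    (hKo : ∀ (N : ℕ) [NeZero N] (W : WeierstrassCurve ℚ) (K : Type) [Field K] [NumberField K], kolyvagin N W K)
    (hnf : exists_isNewformOf) (hHL : HoffsteinLuo1997_exists_twist_L_one_ne_zero)
    (h37 : Literature.NumberTheory.EllipticCurves.GrossLMS1991.prop37_2_frobeniusCongruence)
    (hZ4 : GoodOrdinaryRankZeroAtTwo ∧ MultiplicativeRankZeroAtTwo ∧ SupersingularRankZeroAtTwo ∧ AdditiveRankZeroAtTwo)
    (W : WeierstrassCurve ℚ) [W.IsElliptic] [W.IsGloballyMinimal] [NeZero (W.conductorNorm ℤ)]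
    (hCM : ¬ W.HasCM) (hsurj : ∀ n : ℕ, W.HasSurjectiveModNGaloisRep ((2 ^ n : ℕ) : ℤ)) (hT : Odd W.torsionOrder)
    (hc : Odd W.tamagawaProduct) (hr : W.analyticRank = 1) (hΔ : 0 < W.Δ)
    (K : Type) [iF : Field K] [iN : NumberField K] (hK : IsImaginaryQuadratic K) (hadm : DoorAdmissible W (NumberField.discr K))
    (hLt : (W.quadraticTwist (NumberField.discr K : ℚ)).entireLFunction 1 ≠ 0)
    (hmin : transpCount W (NumberField.discr K) + 2 * identCount W (NumberField.discr K) = (if W.Δ < 0 then 1 else 0))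
    (Dt : ModularParametrizationData W (W.conductorNorm ℤ)) (H : HeegnerDatum (W.conductorNorm ℤ) (NumberField.discr K))
    (ι : K →+* ℂ) (P : (W.baseChange K).toAffine.Point)
    (hP : WeierstrassCurve.Affine.Point.map ι.toRatAlgHom P = heegnerPointComplex Dt H) (hodd : Odd Dt.c)
    (Wd : WeierstrassCurve ℚ) [iE : Wd.IsElliptic] [iM : Wd.IsGloballyMinimal] (Cd : WeierstrassCurve.VariableChange ℚ)
    (hWd : Cd • W.quadraticTwist (NumberField.discr K : ℚ) = Wd)
    (hegg : EggUpToTorsion W K P) : BSDp W 2 :=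
  bsdp_two_of_bottomRung_at_of_rankZero_cruxes_ctFree hGZ hKo hnf hHL h37 hZ4 W hCM hsurj hT hc hr K hK hadm hLt Dt H ι P hP Wd Cd hWd hmin
    hodd (hasTwoDivisibilityUpToTorsion_zero_of_eggUpToTorsion W hΔ (noRationalTwoTorsion_of_odd_torsionOrder W hT) K hK P hegg)

/-! ### §3 Door bookkeeping for -desc's parameter: a desc-admissible door is door-admissible and minimal at `Δ_W > 0` -/

/-- **`t(W, d) = 0` at a desc-admissible `d`**: every prime `q ∣ d` is good, odd, with `a_q(W)` odd, hence `(Δ_min/q) = +1`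
(`TwoAdicTwistConverse.legendreSym_discr_eq_one_of_odd_frobeniusTrace`: a `3`-cycle is an even permutation), so no prime of `d` is a transposition
prime. [cite: Kramer1981, Prop. 3] [cite: SilvermanAEC2009, V.2.3.1] -/
theorem transpCount_eq_zero_of_descAdmissible (W : WeierstrassCurve ℚ) [W.IsElliptic] [W.IsGloballyMinimal] {d : ℤ}
    (h : DescAdmissible W d) : transpCount W d = 0 := by
  obtain ⟨hdneg, -, hd8, hgood, -⟩ := h
  unfold transpCount
  rw [Finset.card_eq_zero, Finset.filter_eq_empty_iff]
  intro q hq hj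
  have hqp : q.Prime := Nat.prime_of_mem_primeFactors hq
  have hqd : (q : ℤ) ∣ d := Int.ofNat_dvd_left.mpr (Nat.dvd_of_mem_primeFactors hq)
  haveI : Fact q.Prime := ⟨hqp⟩
  have hq2 : q ≠ 2 := by
    rintro rfl
    have h2d : (2 : ℤ) ∣ d := by exact_mod_cast hqd
    omega
  obtain ⟨hgoodq, hodd⟩ := hgood q hqp hqd
  have hleg : legendreSym q (minimalDiscriminantInt W) = 1 := legendreSym_discr_eq_one_of_odd_frobeniusTrace W q hq2 (hgoodq ⟨hqp⟩) hodd
  have hnum : W.Δ.num = minimalDiscriminantInt W := by rw [← cast_minimalDiscriminantInt W, Rat.num_intCast]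
  rw [hnum, ← jacobiSym.legendreSym.to_jacobiSym, hleg] at hj
  exact absurd hj (by decide)

/-- **`s(W, d) = 0` at a desc-admissible `d`**: no prime of `d` has `a_q(W)` even. [cite: Kramer1981, Prop. 3] -/
theorem identCount_eq_zero_of_descAdmissible (W : WeierstrassCurve ℚ) [W.IsElliptic] [W.IsGloballyMinimal] {d : ℤ}
    (h : DescAdmissible W d) : identCount W d = 0 := by
  obtain ⟨-, -, -, hgood, -⟩ := h
  unfold identCount
  rw [Finset.card_eq_zero, Finset.filter_eq_empty_iff]
  rintro q hq ⟨-, heven⟩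
  have hqp : q.Prime := Nat.prime_of_mem_primeFactors hq
  have hqd : (q : ℤ) ∣ d := Int.ofNat_dvd_left.mpr (Nat.dvd_of_mem_primeFactors hq)
  exact (Int.not_even_iff_odd.mpr (hgood q hqp hqd).2) heven

/-- **A desc-admissible door is MINIMAL at `Δ_W > 0`** (`t + 2s = 0 = [Δ_W < 0]`). [cite: Kramer1981, Props. 3 and 6] -/
theorem minimal_of_descAdmissible_of_pos (W : WeierstrassCurve ℚ) [W.IsElliptic] [W.IsGloballyMinimal] {d : ℤ} (hΔ : 0 < W.Δ)
    (h : DescAdmissible W d) : transpCount W d + 2 * identCount W d = (if W.Δ < 0 then 1 else 0) := by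
  rw [transpCount_eq_zero_of_descAdmissible W h, identCount_eq_zero_of_descAdmissible W h, if_neg (not_lt.mpr hΔ.le)]

/-! ### §4 THE CLASS THEOREM: under AN-13 the class {`Δ_W > 0`, `Ш(W)[2] = 0`, egg, odd-constant datum} lies on the proved sub-slice -/

/-- **UNDER AN-13, EVERY CURVE OF THE SLICE WITH `Δ_W > 0`, `Ш(W)[2] = 0`, `E(ℚ)` MEETING THE EGG AND AN ODD-CONSTANT PARAMETRISATION DATUM ADMITS A
BOTTOM-RUNG DOOR DATUM** — the `Δ_W > 0` twin of the lead's `hasBottomRungDoorAtTwo_of_heegnerNonDivisibility` (R⁻₀, `Δ_W < 0`), with -an's EXISTING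
conjecture AN-13 `HeegnerPointOnEggAtTwo` in the rôle of R⁻₀.  The DOOR IS SUPPLIED: route GenusKolyvaginAtTwo's Čebotarev theorem
`GenusKolyTwin.exists_silent_prime_heegnerField` gives a silent prime `ℓ ≡ 7 (8)` with `K = ℚ(√−ℓ)` imaginary quadratic, `d_K = −ℓ` DESC-admissible and the
Heegner hypothesis (unconditional, from `ρ̄_{W,2}` onto); a Heegner datum, an embedding and a `K`-RATIONAL point over the complex Heegner point of the
GIVEN odd-constant datum exist (`nonempty_heegnerDatum_holds`, `heegnerPointComplex_mem_range_map_holds`); AN-13 puts that point on the egg up to torsion,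
the egg lemma makes its exponent `0`; a point of exponent `0` has infinite order, so `L'(E/K,1) ≠ 0` (Gross–Zagier, `lDerivEK_ne_zero_iff_not_isOfFinAddOrder`)
and `L(W^{(d_K)},1) ≠ 0` (`lDerivEK_eq_deriv_mul_of_entireLFunction_one_eq_zero`): the door is non-vanishing WITHOUT Hoffstein–Luo at it and WITHOUT any
`2`-converse (the lead's «door opens itself» step of R⁻₀); the door is minimal (§3) and the twist has a globally minimal model (`hasGlobalMinimalModel_rat_holds`).  CONDITIONAL on AN-13 and on
Gross–Zagier, Kolyvagin, modularity, Hoffstein–Luo (the last three only for `rank E(ℚ) = 1`, an input of AN-13); BSD is not proved by this.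
[cite: Zhang2014CJM, Thm. 1.1 (p ≥ 5 analogue; nothing asserted at 2)] [cite: GrossZagier1986, Thm. I.6.3 and V.§2] [cite: Kramer1981, Prop. 6]
[cite: GrossLMS1991, §10] -/
theorem hasBottomRungDoorAtTwo_of_heegnerPointOnEggAtTwo (h13 : HeegnerPointOnEggAtTwo)
    (hGZ : ∀ (N : ℕ) [NeZero N] (W : WeierstrassCurve ℚ) (K : Type) [Field K] [NumberField K], gross_zagier N W K)
    (hKo : ∀ (N : ℕ) [NeZero N] (W : WeierstrassCurve ℚ) (K : Type) [Field K] [NumberField K], kolyvagin N W K)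
    (hnf : exists_isNewformOf) (hHL : HoffsteinLuo1997_exists_twist_L_one_ne_zero)
    (W : WeierstrassCurve ℚ) [W.IsElliptic] [W.IsGloballyMinimal] [NeZero (W.conductorNorm ℤ)]
    (hsurj : ∀ n : ℕ, W.HasSurjectiveModNGaloisRep ((2 ^ n : ℕ) : ℤ)) (hT : Odd W.torsionOrder) (hc : Odd W.tamagawaProduct)
    (hr : W.analyticRank = 1) (hΔ : 0 < W.Δ) (hSha : ShaTwoTrivial W) (hmeets : MeetsEgg W)
    (Dt : ModularParametrizationData W (W.conductorNorm ℤ)) (hodd : Odd Dt.c) : HasBottomRungDoorAtTwo W := by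
  -- the door: a silent prime `ℓ`, `K = ℚ(√-ℓ)`, `d_K = -ℓ` desc-admissible, Heegner
  have hsurj2 : W.HasSurjectiveModNGaloisRep 2 := by simpa using hsurj 1
  obtain ⟨ℓ, -, -, -, -, -, hDA, -, K, iF, iN, hK, hd, -, -, hHN, -, -, -⟩ := exists_silent_prime_heegnerField W hΔ hsurj2 0
  rw [← hd] at hDA
  have hadm : DoorAdmissible W (NumberField.discr K) := ANg16.doorAdmissible_of_descAdmissible W hDA
  have hmin : transpCount W (NumberField.discr K) + 2 * identCount W (NumberField.discr K) = (if W.Δ < 0 then 1 else 0) :=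
    minimal_of_descAdmissible_of_pos W hΔ hDA
  -- the Heegner datum, an embedding, the `K`-rational point over the complex Heegner point of the GIVEN datum `Dt`
  obtain ⟨H, -⟩ :=
    nonempty_heegnerDatum_holds (W.conductorNorm ℤ) K hK (exists_dvd_sq_sub_discr_holds (W.conductorNorm ℤ) K hK hHN).choose_spec
  obtain ⟨ι⟩ : Nonempty (K →+* ℂ) := inferInstance
  obtain ⟨P, hP⟩ := heegnerPointComplex_mem_range_map_holds (W.conductorNorm ℤ) W K hK hHN Dt H ι
  -- AN-13: the point is on the egg up to torsion; the egg lemma: exponent `0`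
  have hrk : W.mordellWeilRank = 1 := (mordellWeilRank_eq_one_of_analyticRank_eq_one_of_isGloballyMinimal hGZ hKo hnf hHL W hr).1
  have hT2 : NoRationalTwoTorsion W := noRationalTwoTorsion_of_odd_torsionOrder W hT
  have hc2 : ¬ 2 ∣ W.tamagawaProduct := fun h => (Nat.not_even_iff_odd.mpr hc) (even_iff_two_dvd.mpr h)
  have hcodd : ¬ (2 : ℤ) ∣ Dt.c := fun h => (Int.not_even_iff_odd.mpr hodd) (even_iff_two_dvd.mpr h)
  have hegg : EggUpToTorsion W K P := h13 W hΔ hT2 hrk hSha hmeets hc2 K hK hDA Dt H ι P hP hcodd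
  have hm0 : HasTwoDivisibilityUpToTorsion W K P 0 := hasTwoDivisibilityUpToTorsion_zero_of_eggUpToTorsion W hΔ hT2 K hK P hegg
  -- the door opens itself: `P` has infinite order ⟹ `L'(E/K,1) ≠ 0` (Gross–Zagier) ⟹ `L(W^{(d_K)},1) ≠ 0`
  have hnt : ¬ IsOfFinAddOrder P := not_isOfFinAddOrder_of_hasTwoDivisibilityUpToTorsion_zero W K P hm0
  have hHeeg : IsHeegnerPoint (W.conductorNorm ℤ) W K P := ⟨Dt, H, ι, hP⟩
  have hLK : LDerivEK W K ≠ 0 :=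
    (lDerivEK_ne_zero_iff_not_isOfFinAddOrder W (W.conductorNorm ℤ) K (hGZ _ W K) hK hHN hHeeg).mpr hnt
  have hmod : hasEntireLFunction_rat := hasEntireLFunction_rat_of_exists_isNewformOf hnf
  have hL0 : W.entireLFunction 1 = 0 := entireLFunction_one_eq_zero_of_analyticRank_eq_one hr
  have hLt : (W.quadraticTwist (NumberField.discr K : ℚ)).entireLFunction 1 ≠ 0 := by
    intro h0
    apply hLK
    rw [lDerivEK_eq_deriv_mul_of_entireLFunction_one_eq_zero hmod W K hL0, h0, mul_zero]
  -- a globally minimal model of the twist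
  have hD0 : (NumberField.discr K : ℚ) ≠ 0 := by exact_mod_cast NumberField.discr_ne_zero K
  haveI hEt : (W.quadraticTwist (NumberField.discr K : ℚ)).IsElliptic := W.isElliptic_quadraticTwist hD0
  obtain ⟨Cd, hCd⟩ := hasGlobalMinimalModel_rat_holds (W.quadraticTwist (NumberField.discr K : ℚ))
  haveI := hCd
  exact hasBottomRungDoorAtTwo_of_eggUpToTorsion W hΔ hT2 K hK hadm hLt hmin Dt H ι P hP hodd
    (Cd • W.quadraticTwist (NumberField.discr K : ℚ)) Cd rfl hegg

/-- **UNDER AN-13: `BSDp W 2` ON THE CLASS {`Δ_W > 0`, `Ш(W)[2] = 0`, egg, odd-constant datum}**, modulo the five printed facts and the route's four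
rank-`0` cruxes — the `Δ_W > 0` twin of the lead's `bsdp_two_of_heegnerNonDivisibility_negDisc`: the class theorem puts `W` on the proved sub-slice,
where U₀ from print makes the datum lawful (`hasLawfulDoorAtTwo_of_hasBottomRungDoorAtTwo_of_print`) and one lawful datum gives `BSD₂(W)`
(`bsdp_two_of_hasLawfulDoorAtTwo_of_rankZero_cruxes`).  CONDITIONAL on AN-13, Gross–Zagier, Kolyvagin, modularity, Hoffstein–Luo, Gross 3.7 (2) and
rank-`0` `BSD₂`; BSD is not proved by this. [cite: Zhang2014CJM, Thm. 1.1] [cite: GrossLMS1991, §10 and Prop. 3.7 (2)] [cite: Kolyvagin1990, Thm. A]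
[cite: GrossZagier1986, Thm. I.6.3 and V.§2] -/
theorem bsdp_two_of_heegnerPointOnEggAtTwo_posDisc (h13 : HeegnerPointOnEggAtTwo)
    (hGZ : ∀ (N : ℕ) [NeZero N] (W : WeierstrassCurve ℚ) (K : Type) [Field K] [NumberField K], gross_zagier N W K)
    (hKo : ∀ (N : ℕ) [NeZero N] (W : WeierstrassCurve ℚ) (K : Type) [Field K] [NumberField K], kolyvagin N W K)
    (hnf : exists_isNewformOf) (hHL : HoffsteinLuo1997_exists_twist_L_one_ne_zero)
    (h37 : Literature.NumberTheory.EllipticCurves.GrossLMS1991.prop37_2_frobeniusCongruence)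
    (hZ4 : GoodOrdinaryRankZeroAtTwo ∧ MultiplicativeRankZeroAtTwo ∧ SupersingularRankZeroAtTwo ∧ AdditiveRankZeroAtTwo)
    (W : WeierstrassCurve ℚ) [W.IsElliptic] [W.IsGloballyMinimal] [NeZero (W.conductorNorm ℤ)]
    (hCM : ¬ W.HasCM) (hsurj : ∀ n : ℕ, W.HasSurjectiveModNGaloisRep ((2 ^ n : ℕ) : ℤ)) (hT : Odd W.torsionOrder)
    (hc : Odd W.tamagawaProduct) (hr : W.analyticRank = 1) (hΔ : 0 < W.Δ) (hSha : ShaTwoTrivial W) (hmeets : MeetsEgg W)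
    (Dt : ModularParametrizationData W (W.conductorNorm ℤ)) (hodd : Odd Dt.c) : BSDp W 2 :=
  bsdp_two_of_hasLawfulDoorAtTwo_of_rankZero_cruxes hGZ hKo hnf hHL hZ4 W hCM hT hc hr
    (hasLawfulDoorAtTwo_of_hasBottomRungDoorAtTwo_of_print hGZ hKo hnf hHL h37 W hCM hsurj hT hc hr
      (hasBottomRungDoorAtTwo_of_heegnerPointOnEggAtTwo h13 hGZ hKo hnf hHL W hsurj hT hc hr hΔ hSha hmeets Dt hodd))

/-- **UNDER AN-13 NO CURVE OF THE CLASS IS OFF THE SUB-SLICE** — the form consumed by a case split of R₊ (`DoorIndexLawFullCAtTwoSomeDoorResiduePlus`, v8.15):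
for `W` of the slice with `0 < Δ_W ∧ ShaTwoTrivial W ∧ MeetsEgg W ∧ ∃ Dt, Odd Dt.c`, the residue hypothesis `¬ HasBottomRungDoorAtTwo W` is CONTRADICTORY,
so R₊ restricted to this class is vacuous given AN-13 (and Gross–Zagier, Kolyvagin, modularity, Hoffstein–Luo).  CONDITIONAL by design; BSD is not proved
by this. [cite: Zhang2014CJM, Thm. 1.1] [cite: GrossLMS1991, Conj. 1.2 and §10] -/
theorem not_offSubslice_of_heegnerPointOnEggAtTwo (h13 : HeegnerPointOnEggAtTwo)
    (hGZ : ∀ (N : ℕ) [NeZero N] (W : WeierstrassCurve ℚ) (K : Type) [Field K] [NumberField K], gross_zagier N W K)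
    (hKo : ∀ (N : ℕ) [NeZero N] (W : WeierstrassCurve ℚ) (K : Type) [Field K] [NumberField K], kolyvagin N W K)
    (hnf : exists_isNewformOf) (hHL : HoffsteinLuo1997_exists_twist_L_one_ne_zero)
    (W : WeierstrassCurve ℚ) [W.IsElliptic] [W.IsGloballyMinimal] [NeZero (W.conductorNorm ℤ)]
    (hsurj : ∀ n : ℕ, W.HasSurjectiveModNGaloisRep ((2 ^ n : ℕ) : ℤ)) (hT : Odd W.torsionOrder) (hc : Odd W.tamagawaProduct)
    (hr : W.analyticRank = 1)
    (hcls : 0 < W.Δ ∧ ShaTwoTrivial W ∧ MeetsEgg W ∧ ∃ Dt : ModularParametrizationData W (W.conductorNorm ℤ), Odd Dt.c)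
    (hoff : ¬ HasBottomRungDoorAtTwo W) : False := by
  obtain ⟨hΔ, hSha, hmeets, Dt, hodd⟩ := hcls
  exact hoff (hasBottomRungDoorAtTwo_of_heegnerPointOnEggAtTwo h13 hGZ hKo hnf hHL W hsurj hT hc hr hΔ hSha hmeets Dt hodd)

/-- **THE NEXT SPLIT (v8.16 pattern, import-free): R₊ FROM «the egg class lies on the sub-slice» AND THE RESIDUE OFF BOTH CLASSES.**  With `hcls`
the class statement (discharged from AN-13 and four printed facts by `hasBottomRungDoorAtTwo_of_heegnerPointOnEggAtTwo`) and `hrest` = R₊ with the extra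
hypothesis «`W` is not in the egg class {`0 < Δ_W`, `Ш(W)[2] = 0`, `MeetsEgg W`, odd-constant datum}» (the body a lead's APPEND would name `…ResiduePlusPlus`:
the curves with `Ш(W)[2] ≠ 0`, or `Δ_W > 0` off the egg, or without an odd-constant datum), R₊ follows by a case split — exactly as the lead's
`doorIndexLawFullCAtTwoSomeDoorOffSubslice_of_residuePlus_of_class` one level up.  Nothing is asserted; BSD is not proved by this.
[cite: GrossLMS1991, Conj. 1.2, §3 and §10] [cite: Zhang2014CJM, Thm. 1.1] -/
theorem doorIndexLawFullCAtTwoSomeDoorResiduePlus_of_eggClass_of_rest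
    (hcls : ∀ (W : WeierstrassCurve ℚ) [W.IsElliptic] [W.IsGloballyMinimal] [NeZero (W.conductorNorm ℤ)],
      ¬ W.HasCM → (∀ n : ℕ, W.HasSurjectiveModNGaloisRep ((2 ^ n : ℕ) : ℤ)) → Odd W.torsionOrder → Odd W.tamagawaProduct →
      W.analyticRank = 1 → 0 < W.Δ → ShaTwoTrivial W → MeetsEgg W →
      ∀ Dt : ModularParametrizationData W (W.conductorNorm ℤ), Odd Dt.c → HasBottomRungDoorAtTwo W)
    (hrest : ∀ (W : WeierstrassCurve ℚ) [W.IsElliptic] [W.IsGloballyMinimal] [NeZero (W.conductorNorm ℤ)],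
      ¬ W.HasCM → (∀ n : ℕ, W.HasSurjectiveModNGaloisRep ((2 ^ n : ℕ) : ℤ)) → Odd W.torsionOrder → Odd W.tamagawaProduct →
      W.analyticRank = 1 → ¬ HasBottomRungDoorAtTwo W →
      ¬ (W.Δ < 0 ∧ ShaTwoTrivial W ∧ ∃ Dt : ModularParametrizationData W (W.conductorNorm ℤ), Odd Dt.c) →
      ¬ (0 < W.Δ ∧ ShaTwoTrivial W ∧ MeetsEgg W ∧ ∃ Dt : ModularParametrizationData W (W.conductorNorm ℤ), Odd Dt.c) →
      HasLawfulDoorAtTwo W) :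
    DoorIndexLawFullCAtTwoSomeDoorResiduePlus := by
  intro W _ _ _ hCM hsurj hT hc hr hoff hneg
  by_cases hin : 0 < W.Δ ∧ ShaTwoTrivial W ∧ MeetsEgg W ∧ ∃ Dt : ModularParametrizationData W (W.conductorNorm ℤ), Odd Dt.c
  · obtain ⟨hΔ, hSha, hmeets, Dt, hodd⟩ := hin
    exact absurd (hcls W hCM hsurj hT hc hr hΔ hSha hmeets Dt hodd) hoff
  · exact hrest W hCM hsurj hT hc hr hoff hneg hin

/-- **… and with the class hypothesis DISCHARGED from AN-13** (plus Gross–Zagier, Kolyvagin, modularity, Hoffstein–Luo): R₊ from AN-13 and the residue off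
both classes.  CONDITIONAL by design; BSD is not proved by this. [cite: Zhang2014CJM, Thm. 1.1] [cite: GrossLMS1991, Conj. 1.2 and §10] -/
theorem doorIndexLawFullCAtTwoSomeDoorResiduePlus_of_heegnerPointOnEggAtTwo_of_rest (h13 : HeegnerPointOnEggAtTwo)
    (hGZ : ∀ (N : ℕ) [NeZero N] (W : WeierstrassCurve ℚ) (K : Type) [Field K] [NumberField K], gross_zagier N W K)
    (hKo : ∀ (N : ℕ) [NeZero N] (W : WeierstrassCurve ℚ) (K : Type) [Field K] [NumberField K], kolyvagin N W K)
    (hnf : exists_isNewformOf) (hHL : HoffsteinLuo1997_exists_twist_L_one_ne_zero)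
    (hrest : ∀ (W : WeierstrassCurve ℚ) [W.IsElliptic] [W.IsGloballyMinimal] [NeZero (W.conductorNorm ℤ)],
      ¬ W.HasCM → (∀ n : ℕ, W.HasSurjectiveModNGaloisRep ((2 ^ n : ℕ) : ℤ)) → Odd W.torsionOrder → Odd W.tamagawaProduct →
      W.analyticRank = 1 → ¬ HasBottomRungDoorAtTwo W →
      ¬ (W.Δ < 0 ∧ ShaTwoTrivial W ∧ ∃ Dt : ModularParametrizationData W (W.conductorNorm ℤ), Odd Dt.c) →
      ¬ (0 < W.Δ ∧ ShaTwoTrivial W ∧ MeetsEgg W ∧ ∃ Dt : ModularParametrizationData W (W.conductorNorm ℤ), Odd Dt.c) →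
      HasLawfulDoorAtTwo W) :
    DoorIndexLawFullCAtTwoSomeDoorResiduePlus :=
  doorIndexLawFullCAtTwoSomeDoorResiduePlus_of_eggClass_of_rest
    (fun W _ _ _ _ hsurj hT hc hr hΔ hSha hmeets Dt hodd =>
      hasBottomRungDoorAtTwo_of_heegnerPointOnEggAtTwo h13 hGZ hKo hnf hHL W hsurj hT hc hr hΔ hSha hmeets Dt hodd)
    hrest

/-! ### §5 Per-datum forms under AN-13 at a given door -/

/-- **UNDER AN-13, EVERY MINIMAL ODD-CONSTANT NON-VANISHING DOOR DATUM OF AN EGG CURVE WITH `Ш(W)[2] = 0` IS A BOTTOM-RUNG DATUM** (`Δ_W > 0`; rank one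
from Gross–Zagier + Kolyvagin + modularity + Hoffstein–Luo).  -an's `HeegnerPointOnEggAtTwo` (CONJECTURE, hypothesis `h13`) applies at the datum: the door
is desc-admissible (`descAdmissible_of_doorAdmissible_of_counts_eq_zero`, `t = s = 0` at `Δ_W > 0`), the constant odd, so the Heegner point is
rational-on-the-egg up to torsion, and §2 concludes.  CONDITIONAL on AN-13 and four printed facts; BSD is not proved by this.
[cite: Zhang2014CJM, Thm. 1.1] [cite: Kramer1981, Prop. 6] [cite: GrossLMS1991, §10] -/
theorem hasBottomRungDoorAtTwo_of_heegnerPointOnEggAtTwo_at (h13 : HeegnerPointOnEggAtTwo)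
    (hGZ : ∀ (N : ℕ) [NeZero N] (W : WeierstrassCurve ℚ) (K : Type) [Field K] [NumberField K], gross_zagier N W K)
    (hKo : ∀ (N : ℕ) [NeZero N] (W : WeierstrassCurve ℚ) (K : Type) [Field K] [NumberField K], kolyvagin N W K)
    (hnf : exists_isNewformOf) (hHL : HoffsteinLuo1997_exists_twist_L_one_ne_zero)
    (W : WeierstrassCurve ℚ) [W.IsElliptic] [W.IsGloballyMinimal] [NeZero (W.conductorNorm ℤ)]
    (hT : Odd W.torsionOrder) (hc : Odd W.tamagawaProduct) (hr : W.analyticRank = 1) (hΔ : 0 < W.Δ) (hSha : ShaTwoTrivial W)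
    (hmeets : MeetsEgg W)
    (K : Type) [iF : Field K] [iN : NumberField K] (hK : IsImaginaryQuadratic K) (hadm : DoorAdmissible W (NumberField.discr K))
    (hLt : (W.quadraticTwist (NumberField.discr K : ℚ)).entireLFunction 1 ≠ 0)
    (hmin : transpCount W (NumberField.discr K) + 2 * identCount W (NumberField.discr K) = (if W.Δ < 0 then 1 else 0))
    (Dt : ModularParametrizationData W (W.conductorNorm ℤ)) (H : HeegnerDatum (W.conductorNorm ℤ) (NumberField.discr K))
    (ι : K →+* ℂ) (P : (W.baseChange K).toAffine.Point)
    (hP : WeierstrassCurve.Affine.Point.map ι.toRatAlgHom P = heegnerPointComplex Dt H) (hodd : Odd Dt.c)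
    (Wd : WeierstrassCurve ℚ) [iE : Wd.IsElliptic] [iM : Wd.IsGloballyMinimal] (Cd : WeierstrassCurve.VariableChange ℚ)
    (hWd : Cd • W.quadraticTwist (NumberField.discr K : ℚ) = Wd) :
    HasBottomRungDoorAtTwo W := by
  have hmin' := hmin
  rw [if_neg (not_lt.mpr hΔ.le)] at hmin'
  have ht : transpCount W (NumberField.discr K) = 0 := by omega
  have hs : identCount W (NumberField.discr K) = 0 := by omega
  have hdesc : DescAdmissible W (NumberField.discr K) := descAdmissible_of_doorAdmissible_of_counts_eq_zero W hadm ht hs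
  have hrk : W.mordellWeilRank = 1 := (mordellWeilRank_eq_one_of_analyticRank_eq_one_of_isGloballyMinimal hGZ hKo hnf hHL W hr).1
  have hT2 : NoRationalTwoTorsion W := noRationalTwoTorsion_of_odd_torsionOrder W hT
  have hc2 : ¬ 2 ∣ W.tamagawaProduct := fun h => (Nat.not_even_iff_odd.mpr hc) (even_iff_two_dvd.mpr h)
  have hcodd : ¬ (2 : ℤ) ∣ Dt.c := fun h => (Int.not_even_iff_odd.mpr hodd) (even_iff_two_dvd.mpr h)
  have hegg : EggUpToTorsion W K P := h13 W hΔ hT2 hrk hSha hmeets hc2 K hK hdesc Dt H ι P hP hcodd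
  exact hasBottomRungDoorAtTwo_of_eggUpToTorsion W hΔ hT2 K hK hadm hLt hmin Dt H ι P hP hodd Wd Cd hWd hegg

/-- **On `{Δ_W > 0}` THE SUB-SLICE AND THE EGG: a bottom-rung door datum forces the egg bit (companion file, modulo print), and conversely an egg
HEEGNER datum is a bottom-rung datum (§2, unconditional).**  Packaged two-sided form at a given minimal odd-constant non-vanishing admissible door datum
with `Δ_W > 0`, modulo the five printed facts: `EggUpToTorsion W K P → HasBottomRungDoorAtTwo W` and `HasBottomRungDoorAtTwo W → MeetsEgg W`.
CONDITIONAL by design; BSD is not proved by this. [cite: Kramer1981, Prop. 6] [cite: GrossLMS1991, §10] -/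
theorem eggUpToTorsion_imp_bottomRung_imp_meetsEgg
    (hGZ : ∀ (N : ℕ) [NeZero N] (W : WeierstrassCurve ℚ) (K : Type) [Field K] [NumberField K], gross_zagier N W K)
    (hKo : ∀ (N : ℕ) [NeZero N] (W : WeierstrassCurve ℚ) (K : Type) [Field K] [NumberField K], kolyvagin N W K)
    (hnf : exists_isNewformOf) (hHL : HoffsteinLuo1997_exists_twist_L_one_ne_zero)
    (h37 : Literature.NumberTheory.EllipticCurves.GrossLMS1991.prop37_2_frobeniusCongruence)
    (W : WeierstrassCurve ℚ) [W.IsElliptic] [W.IsGloballyMinimal] [NeZero (W.conductorNorm ℤ)]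
    (hCM : ¬ W.HasCM) (hsurj : ∀ n : ℕ, W.HasSurjectiveModNGaloisRep ((2 ^ n : ℕ) : ℤ)) (hT : Odd W.torsionOrder)
    (hc : Odd W.tamagawaProduct) (hr : W.analyticRank = 1) (hΔ : 0 < W.Δ)
    (K : Type) [iF : Field K] [iN : NumberField K] (hK : IsImaginaryQuadratic K) (hadm : DoorAdmissible W (NumberField.discr K))
    (hLt : (W.quadraticTwist (NumberField.discr K : ℚ)).entireLFunction 1 ≠ 0)
    (hmin : transpCount W (NumberField.discr K) + 2 * identCount W (NumberField.discr K) = (if W.Δ < 0 then 1 else 0))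
    (Dt : ModularParametrizationData W (W.conductorNorm ℤ)) (H : HeegnerDatum (W.conductorNorm ℤ) (NumberField.discr K))
    (ι : K →+* ℂ) (P : (W.baseChange K).toAffine.Point)
    (hP : WeierstrassCurve.Affine.Point.map ι.toRatAlgHom P = heegnerPointComplex Dt H) (hodd : Odd Dt.c)
    (Wd : WeierstrassCurve ℚ) [iE : Wd.IsElliptic] [iM : Wd.IsGloballyMinimal] (Cd : WeierstrassCurve.VariableChange ℚ)
    (hWd : Cd • W.quadraticTwist (NumberField.discr K : ℚ) = Wd) :
    (EggUpToTorsion W K P → HasBottomRungDoorAtTwo W) ∧ (HasBottomRungDoorAtTwo W → MeetsEgg W) :=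
  ⟨fun hegg => hasBottomRungDoorAtTwo_of_eggUpToTorsion W hΔ (noRationalTwoTorsion_of_odd_torsionOrder W hT) K hK hadm hLt hmin Dt H ι P
      hP hodd Wd Cd hWd hegg,
    fun hdoor => meetsEgg_of_hasBottomRungDoorAtTwo hGZ hKo hnf hHL h37 W hCM hsurj hT hc hr hΔ hdoor⟩

end Summit.BirchSwinnertonDyer.BirchSwinnertonDyer.Theorems.RankOneAtTwoOneDoor

end
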